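import Literature.IUT.HodgeArakelov.CohomologyAutEquiv
import Literature.IUT.HodgeArakelov.CohomologyLimitConj

/-!
# The automorphism-pair action on `lim_K H¹(H|_K, A)` INTERTWINES the conjugation action: `ρ_(α,β) ∘ conj_σ = conj_{α σ} ∘ ρ_(α,β)`

Proof-only companion (abc-iut cell, seat abc-iut-w5-d169 gen 2; junction J10 of
`plan/L6/SUBDAG-IUTchII-Prop-31-33-34.md`) to abc-iut-L6-t1's `CohomologyAutFunctoriality.lean` (`h1LimAut`, and the
`H¹`-level equivariance `ContH1Aut.autMap_conj`) and abc-iut-w4-d043's `CohomologyLimitConj.lean` (`h1LimConj`, the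
conjugation action of `Π` on the limit through normal cores).  It lifts `autMap_conj` to the LIMIT:

  `h1LimAut (α, β) (h1LimConj σ z) = h1LimConj (α σ) (h1LimAut (α, β) z)`   (`h1LimAut_h1LimConj`),

with the `AddEquiv` forms for `h1LimAutEquiv` / `h1LimConjEquiv`.  This is the `map_conj` field of an isomorphism of
theta-environment data along `α` ([IUTchII] Prop 3.4 (i) p. 91: the isomorphisms "are compatible with the respective
conjugation actions"), and the reason why the pair action carries the `Π`-conjugacy class of an inversion action to
the conjugacy class of its transform ("conjugates of inversion automorphisms are inversion automorphisms",
Prop 2.2 (i)).  Standard transport of structure [cite: NeukirchSchmidtWingberg2008, I §5]; nothing of [IUTchII] is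
asserted; no side taken on [IUTchIII] Cor 3.12.
-/

namespace Literature.IUT.HodgeArakelov

open Literature.AnabelianGeometry.EtaleTheta CohomologySystemOfContH1

universe u

noncomputable section

section Limit

variable {P : TopGroup.{u}} {G' : Type u} [Group G'] [TopologicalSpace G'] [IsTopologicalGroup G']
  (φ : P →* G') (A : Subgroup G') [A.Normal] [IsMulCommutative A] (H : Subgroup P) [H.Normal]
  (α : P ≃ₜ* P) (β : G' ≃ₜ* G') (hφ : ∀ g, β (φ g) = φ (α g)) (hA : ∀ a : G', a ∈ A → β a ∈ A)
  (hH : ∀ x, x ∈ H ↔ α x ∈ H)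

omit [IsTopologicalGroup G'] [A.Normal] [IsMulCommutative A] [H.Normal] in
/-- The image under `α` of a NORMAL finite-index open level is normal. [cite: NeukirchSchmidtWingberg2008, I §5] -/
theorem Idx.normal_mapAut (j : Idx (P := P) ⊥) [hj : (j.K).Normal] : ((Idx.mapAut α j).K).Normal := by
  rw [Idx.K_mapAut]
  exact Subgroup.Normal.map hj _ α.surjective

omit [IsTopologicalGroup G'] [A.Normal] [IsMulCommutative A] in
/-- … hence so is its intersection with the normal `H`. [cite: NeukirchSchmidtWingberg2008, I §5] -/
theorem Idx.normal_inf_mapAut (j : Idx (P := P) ⊥) [hj : (j.K).Normal] : (H ⊓ (Idx.mapAut α j).K).Normal :=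
  haveI := Idx.normal_mapAut α j
  Subgroup.normal_inf_normal H _

/-- **The pair action intertwines conjugation** on `lim_K H¹(H|_K, A)`:
`h1LimAut (α, β) ∘ h1LimConj σ = h1LimConj (α σ) ∘ h1LimAut (α, β)` — the limit form of abc-iut-L6-t1's
`ContH1Aut.autMap_conj` (computed at the normal level `α(core K)`). [cite: NeukirchSchmidtWingberg2008, I §5] -/
theorem h1LimAut_h1LimConj (σ : P) (z : h1Lim φ A H ⊥) :
    h1LimAut φ A H α β hφ hA hH (h1LimConj φ A H σ z) =
      h1LimConj φ A H (α σ) (h1LimAut φ A H α β hφ hA hH z) := by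
  have key : (h1LimAut φ A H α β hφ hA hH).comp (h1LimConj φ A H σ) =
      (h1LimConj φ A H (α σ)).comp (h1LimAut φ A H α β hφ hA hH) := by
    refine h1Lim_hom_ext φ A H fun i y => ?_
    haveI hN₁ : (H ⊓ (Idx.mapAut α i.core).K).Normal := Idx.normal_inf_mapAut H α i.core
    haveI hN₂ : (H ⊓ (i.core.K).map α.toMulEquiv.toMonoidHom).Normal := hN₁
    rw [AddMonoidHom.comp_apply, AddMonoidHom.comp_apply, h1LimConj_of, conjAt_apply, h1LimAut_of, h1LimAut_of]
    -- right-hand side: move `h1Of (α K)` up to the normal level `α (core K)` and conjugate there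
    have hle : Idx.mapAut α i ≤ Idx.mapAut α i.core := Idx.mapAut_mono α i.le_core
    rw [← h1Of_fmod φ A H ⊥ hle, h1LimConj_of_normal]
    congr 1
    -- both sides are `conj (α σ)` of the transport of the restriction of `y` to `H ⊓ core K`
    have h1 : fmod φ A H ⊥ (Idx.mapAut α i) (Idx.mapAut α i.core) hle
        (Additive.ofMul (ContH1Aut.autMap φ A α β hφ hA (symm_mem_inf H α hH i.K) (Additive.toMul y))) =
        Additive.ofMul (ContH1Aut.autMap φ A α β hφ hA (symm_mem_inf H α hH i.core.K)
          (Additive.toMul (fmod φ A H ⊥ i i.core i.le_core y))) :=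
      congrArg Additive.ofMul (ContH1Aut.res_autMap φ A α β hφ hA
        (inf_le_inf_left H (Idx.le_iff.mp i.le_core)) (inf_le_inf_left H (Idx.le_iff.mp hle))
        (symm_mem_inf H α hH i.core.K) (symm_mem_inf H α hH i.K) (Additive.toMul y))
    rw [h1]
    exact congrArg Additive.ofMul (ContH1Aut.autMap_conj φ A α β hφ hA (symm_mem_inf H α hH i.core.K) σ
      (Additive.toMul (fmod φ A H ⊥ i i.core i.le_core y)))
  exact DFunLike.congr_fun key z

/-- `AddEquiv` form: abc-iut-L6-t1's `h1LimAutEquiv` intertwines abc-iut-w4-d043's `h1LimConjEquiv`.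
[cite: NeukirchSchmidtWingberg2008, I §5] -/
theorem h1LimAutEquiv_h1LimConjEquiv (hA' : ∀ a : G', a ∈ A ↔ β a ∈ A) (σ : P) (z : h1Lim φ A H ⊥) :
    h1LimAutEquiv φ A H α β hφ hA' hH (h1LimConjEquiv φ A H σ z) =
      h1LimConjEquiv φ A H (α σ) (h1LimAutEquiv φ A H α β hφ hA' hH z) := by
  rw [h1LimAutEquiv_apply, h1LimAutEquiv_apply, h1LimConjEquiv_apply, h1LimConjEquiv_apply]
  exact h1LimAut_h1LimConj φ A H α β hφ _ hH σ z

/-- Consequently the pair action CONJUGATES the `Π`-conjugate family of any limit automorphism `ρ` into the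
`Π`-conjugate family of its transform `ρ' := ρ_(α,β) ∘ ρ ∘ ρ_(α,β)⁻¹`:
`ρ_(α,β) ∘ (conj_h ∘ ρ ∘ conj_h⁻¹) ∘ ρ_(α,β)⁻¹ = conj_{α h} ∘ ρ' ∘ conj_{α h}⁻¹` (pointwise form).
[cite: NeukirchSchmidtWingberg2008, I §5] -/
theorem h1LimAutEquiv_conjugate_family (hA' : ∀ a : G', a ∈ A ↔ β a ∈ A)
    (ρ : h1Lim φ A H ⊥ ≃+ h1Lim φ A H ⊥) (h : P) (x : h1Lim φ A H ⊥) :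
    h1LimAutEquiv φ A H α β hφ hA' hH
        (h1LimConjEquiv φ A H h (ρ (h1LimConjEquiv φ A H h⁻¹ ((h1LimAutEquiv φ A H α β hφ hA' hH).symm x)))) =
      h1LimConjEquiv φ A H (α h) (h1LimAutEquiv φ A H α β hφ hA' hH
        (ρ ((h1LimAutEquiv φ A H α β hφ hA' hH).symm (h1LimConjEquiv φ A H (α h)⁻¹ x)))) := by
  have key : h1LimConjEquiv φ A H h⁻¹ ((h1LimAutEquiv φ A H α β hφ hA' hH).symm x) =
      (h1LimAutEquiv φ A H α β hφ hA' hH).symm (h1LimConjEquiv φ A H (α h)⁻¹ x) := by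
    apply (h1LimAutEquiv φ A H α β hφ hA' hH).injective
    rw [h1LimAutEquiv_h1LimConjEquiv, AddEquiv.apply_symm_apply, AddEquiv.apply_symm_apply, map_inv]
  rw [h1LimAutEquiv_h1LimConjEquiv, key]

end Limit

end

end Literature.IUT.HodgeArakelov
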